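import Summits.HodgeConjecture.HodgeConjecture.Cruxes.BlochSeedDiscOne.PhaseTorusLaw

/-!
# Phase-torus law at ALL coranks? — the corank threshold (s4-prove-2 g0, director-hodge R19.171 block F1, 2026-08-29)

Crux of record: `…Theses.EightfoldBlochSeeds.BlochSeedDiscOne` (item stmt-HodgeConjecture-18881).  Nothing in this file proves HC,
HC_AV, HC_CM, H2 or 18881; it is a kernel theorem of finite harmonic analysis on the phase torus `(μ₄)⁴`, companion of
`PhaseTorusLaw.lean` v4 7c21a751 (`phaseTorusLaw_holds` = corank ≤ 4, `phaseTorusLaw7_holds` = corank ≤ 7) and of the design-level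
dictionary `LinePhaseTorus.lean` 7bccd058 (`lineTwoTermUp_mu_eq_zero_of_law γ` takes exactly `PhaseTorusLawN γ` below, unfolded).

TASK: «PHASE-TORUS LAW at ALL coranks — remove the ≤ 7 bound (covering-lemma induction or a character-sum argument uniform in corank)».
ANSWER (kernel, this file; pen + stdlib numerics in `PHASE-TORUS-ALLCORANK-s4p2.md`):
* **FALSE from corank 16 on**: `not_phaseTorusLawN_sixteen`, `not_phaseTorusLawN_of_le`, `not_phaseTorusLawAll`.  Witness
  `ω₁₆ = 16·𝟙_L − 1 + Re χ₁₁₁₁`, `L = 2·(ℤ/4)⁴` (16 phases): all 79 clean moments vanish, `ω₁₆ ≤ 0` off `L`, top moment `128`.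
  So NO corank-uniform argument exists; the critical corank satisfies `9 ≤ γ* ≤ 16`.
* TRUE corank-free statements: the E8 LAW `e8Law` (positive phases inside a coset of the even-weight code `E8` ⇒ `μ = 0`; four closed-form
  certificates `1 − Re χ`, `1 − Re χ ± Im χ`, `1 + Re χ − 2·𝟙_L Re χ`), and v4's BOX LAW (hosted positive set ⇒ `μ = 0`, `rot_step`, any size).
* **corank 8 TRUE (kernel, unconditional)**: `phaseTorusLaw8_holds : PhaseTorusLawN 8` — from the box law (`boxLaw_holds`, v4's
  `rot_step` with a general free coordinate), the E8 law, and the DICHOTOMY «a set of ≤ 8 phases of `(ℤ/4)⁴` is box-hosted or inside an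
  E8-coset» (`eightDichotomy_holds`, §7, a pen proof WITHOUT enumeration: hosting counts ⇒ every box holds exactly two points, opposite
  elsewhere ⇒ all differences lie in `E8`).  So the threshold is `9 ≤ γ* ≤ 16` with BOTH ends kernel theorems (`threshold_kernel`).
-/

namespace Summit.HodgeConjecture.HodgeConjecture.Cruxes.BlochSeedDiscOne.PhaseTorus

open Finset BigOperators

/-! ## §1 The law at corank `≤ γ`; monotonicity; the corank-free form -/

/-- **phase-torus law at corank `≤ γ`** (`γ = 4`: `PhaseTorusLaw` by `rfl`; `γ = 7`: v4's `PhaseTorusLaw7` by `rfl`). -/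
def PhaseTorusLawN (γ : ℕ) : Prop :=
  ∀ (ω : PT → ℝ) (A : Finset PT), A.card ≤ γ → (∀ τ, τ ∉ A → ω τ ≤ 0) →
    (∀ k, KAdm k → moment ω k = 0) → moment ω (fun _ => 1) = 0

/-- the corank-free («all coranks») form: no cardinality bound on the positive set. -/
def PhaseTorusLawAll : Prop :=
  ∀ (ω : PT → ℝ) (A : Finset PT), (∀ τ, τ ∉ A → ω τ ≤ 0) →
    (∀ k, KAdm k → moment ω k = 0) → moment ω (fun _ => 1) = 0

/-- monotone in the corank bound. -/
theorem phaseTorusLawN_mono {γ γ' : ℕ} (h : γ' ≤ γ) (H : PhaseTorusLawN γ) : PhaseTorusLawN γ' :=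
  fun ω A hA hω hK => H ω A (hA.trans h) hω hK

/-- `PhaseTorusLawN 4` IS `PhaseTorusLaw`. -/
theorem phaseTorusLawN_four_iff : PhaseTorusLawN 4 ↔ PhaseTorusLaw := Iff.rfl

/-- corank `≤ 4` (v3/v4 `phaseTorusLaw_holds`). -/
theorem phaseTorusLawN_four : PhaseTorusLawN 4 := phaseTorusLaw_holds

/-- corank `≤ 7` (v4 `phaseTorusLaw7_holds`, the sharp BOX-covering range). -/
theorem phaseTorusLawN_seven : PhaseTorusLawN 7 := phaseTorusLaw7_holds

/-- the corank-free law is the conjunction of all finite-corank laws. -/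
theorem phaseTorusLawAll_iff : PhaseTorusLawAll ↔ ∀ γ, PhaseTorusLawN γ :=
  ⟨fun H _ ω A _ hω hK => H ω A hω hK, fun H ω A hω hK => H A.card ω A le_rfl hω hK⟩

/-! ## §2 Character calculus (local names `u4…`, parallel to v4's `e…`; kept self-contained) -/

/-- `u4 s = i^s` on `ℤ/4`. -/
noncomputable def u4 (s : ZMod 4) : ℂ := Complex.I ^ s.val

theorem u4_zero : u4 0 = 1 := by simp [u4]

theorem u4_add (x y : ZMod 4) : u4 (x + y) = u4 x * u4 y := by
  unfold u4
  rw [← pow_add, ZMod.val_add]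
  conv_rhs => rw [← Nat.div_add_mod (x.val + y.val) 4, pow_add, pow_mul, Complex.I_pow_four, one_pow, one_mul]

theorem u4_one : u4 1 = Complex.I := by
  rw [u4, show (1 : ZMod 4).val = 1 from by decide, pow_one]

theorem u4_two : u4 2 = -1 := by
  rw [u4, show (2 : ZMod 4).val = 2 from by decide, Complex.I_sq]

theorem u4_three : u4 3 = -Complex.I := by
  rw [u4, show (3 : ZMod 4).val = 3 from by decide, pow_succ, Complex.I_sq]; ring

theorem cases_zmod4 (x : ZMod 4) : x = 0 ∨ x = 1 ∨ x = 2 ∨ x = 3 := by revert x; decide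

theorem sum_zmod4 {M : Type*} [AddCommMonoid M] (g : ZMod 4 → M) : ∑ j, g j = g 0 + g 1 + g 2 + g 3 := by
  have h : (Finset.univ : Finset (ZMod 4)) = {0, 1, 2, 3} := by decide
  rw [h, Finset.sum_insert (by decide), Finset.sum_insert (by decide), Finset.sum_insert (by decide),
    Finset.sum_singleton, add_assoc, add_assoc]

theorem u4_sum (s : Fin 4 → ZMod 4) : u4 (∑ f, s f) = ∏ f, u4 (s f) := by
  rw [Fin.sum_univ_four, Fin.prod_univ_four, u4_add, u4_add, u4_add]

/-- `chi k τ = u4 (Σ_f k_f τ_f) = Π_f u4 (k_f τ_f)`. -/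
theorem chi_eq_u4 (k τ : PT) : chi k τ = u4 (∑ f, k f * τ f) := rfl

theorem chi_eq_prod_u4 (k τ : PT) : chi k τ = ∏ f, u4 (k f * τ f) := by
  rw [chi_eq_u4, ← u4_sum]

/-- `u4 (-x) = conj (u4 x)`. -/
theorem u4_neg (x : ZMod 4) : u4 (-x) = (starRingEnd ℂ) (u4 x) := by
  rcases cases_zmod4 x with rfl | rfl | rfl | rfl
  · simp [u4_zero]
  · rw [show (-1 : ZMod 4) = 3 from by decide, u4_three, u4_one, Complex.conj_I]
  · rw [show (-2 : ZMod 4) = 2 from by decide, u4_two]; simp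
  · rw [show (-3 : ZMod 4) = 1 from by decide, u4_one, u4_three, map_neg, Complex.conj_I, neg_neg]

/-- `χ_{−k} = conj χ_k`. -/
theorem chi_neg (k τ : PT) : chi (-k) τ = (starRingEnd ℂ) (chi k τ) := by
  rw [chi_eq_u4, chi_eq_u4, ← u4_neg]
  congr 1
  simp only [Pi.neg_apply, neg_mul, Finset.sum_neg_distrib]

/-- real measures: `ω̂(−k) = conj ω̂(k)`. -/
theorem moment_neg (ω : PT → ℝ) (k : PT) : moment ω (-k) = (starRingEnd ℂ) (moment ω k) := by
  unfold moment
  rw [map_sum]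
  refine Finset.sum_congr rfl fun τ _ => ?_
  rw [map_mul, Complex.conj_ofReal, chi_neg]

/-- `ω̂(3,3,3,3) = conj ω̂(1,1,1,1)`. -/
theorem moment_three (ω : PT → ℝ) : moment ω (fun _ => 3) = (starRingEnd ℂ) (moment ω (fun _ => 1)) := by
  rw [show (fun _ => (3 : ZMod 4) : PT) = -(fun _ => 1) from funext fun _ => by rw [Pi.neg_apply]; decide]
  exact moment_neg ω _

/-- one-coordinate character sum: `Σ_s i^{js} = 4·[j = 0]`. -/
theorem charSum_u4 (j : ZMod 4) : ∑ s : ZMod 4, u4 (j * s) = if j = 0 then 4 else 0 := by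
  rcases cases_zmod4 j with rfl | rfl | rfl | rfl
  · rw [if_pos rfl, sum_zmod4]; simp only [zero_mul, u4_zero]; norm_num
  · rw [if_neg (by decide), sum_zmod4, mul_zero, mul_one, (by decide : (1 : ZMod 4) * 2 = 2),
      (by decide : (1 : ZMod 4) * 3 = 3), u4_zero, u4_one, u4_two, u4_three]; ring
  · rw [if_neg (by decide), sum_zmod4, mul_zero, mul_one, (by decide : (2 : ZMod 4) * 2 = 0),
      (by decide : (2 : ZMod 4) * 3 = 2), u4_zero, u4_two]; ring
  · rw [if_neg (by decide), sum_zmod4, mul_zero, mul_one, (by decide : (3 : ZMod 4) * 2 = 2),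
      (by decide : (3 : ZMod 4) * 3 = 1), u4_zero, u4_one, u4_two, u4_three]; ring

/-- full character sum: `Σ_τ χ_k(τ) = 256·[k = 0]`. -/
theorem sum_chi (k : PT) : ∑ τ : PT, chi k τ = if k = 0 then 256 else 0 := by
  have h : ∑ τ : PT, chi k τ = ∏ f, ∑ s : ZMod 4, u4 (k f * s) := by
    simp_rw [chi_eq_prod_u4]
    rw [Finset.prod_univ_sum]
    simp only [Fintype.piFinset_univ]
  rw [h]
  by_cases hk : k = 0
  · subst hk
    rw [if_pos rfl, Finset.prod_congr rfl fun f _ => by rw [charSum_u4, if_pos (Pi.zero_apply _)]]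
    simp; norm_num
  · rw [if_neg hk]
    obtain ⟨f, hf⟩ : ∃ f, k f ≠ 0 := by
      by_contra hne; push Not at hne; exact hk (funext hne)
    exact Finset.prod_eq_zero (Finset.mem_univ f) (by rw [charSum_u4, if_neg hf])

/-- shifted character sum: `Σ_τ χ_1111(τ) χ_k(τ) = Σ_τ χ_{k+1111}(τ)`. -/
theorem chi_mul_chi (k k' τ : PT) : chi k τ * chi k' τ = chi (k + k') τ := by
  rw [chi_eq_u4, chi_eq_u4, chi_eq_u4, ← u4_add]
  congr 1
  rw [← Finset.sum_add_distrib]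
  exact Finset.sum_congr rfl fun f _ => by rw [Pi.add_apply, add_mul]

/-! ## §3 The even sublattice `L = 2·(ℤ/4)⁴` and its character sums -/

/-- the EVEN SUBLATTICE `L = 2·(ℤ/4)⁴`: all four phase exponents in `{0, 2}` (16 phases; self-dual: `L^⊥ = L`). -/
def evenSet : Finset PT := Fintype.piFinset fun _ : Fin 4 => ({0, 2} : Finset (ZMod 4))

theorem mem_evenSet {τ : PT} : τ ∈ evenSet ↔ ∀ f, τ f = 0 ∨ τ f = 2 := by
  simp [evenSet, Fintype.mem_piFinset]

/-- `|L| = 16`. -/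
theorem evenSet_card : evenSet.card = 16 := by
  rw [evenSet, Fintype.card_piFinset]
  simp [Finset.card_pair (show (0 : ZMod 4) ≠ 2 by decide)]

theorem pairSum_u4 (j : ZMod 4) : u4 (j * 0) + u4 (j * 2) = if j = 0 ∨ j = 2 then 2 else 0 := by
  rcases cases_zmod4 j with rfl | rfl | rfl | rfl
  · rw [if_pos (Or.inl rfl), mul_zero, zero_mul, u4_zero]; norm_num
  · rw [if_neg (by decide), mul_zero, (by decide : (1 : ZMod 4) * 2 = 2), u4_zero, u4_two]; norm_num
  · rw [if_pos (Or.inr rfl), mul_zero, (by decide : (2 : ZMod 4) * 2 = 0), u4_zero]; norm_num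
  · rw [if_neg (by decide), mul_zero, (by decide : (3 : ZMod 4) * 2 = 2), u4_zero, u4_two]; norm_num

/-- character sum over `L`: `Σ_{τ ∈ L} χ_k(τ) = 16·[k ∈ L]` (so `16·𝟙_L = Σ_{δ ∈ L} χ_δ`). -/
theorem sum_chi_evenSet (k : PT) : ∑ τ ∈ evenSet, chi k τ = if k ∈ evenSet then 16 else 0 := by
  have h : ∑ τ ∈ evenSet, chi k τ = ∏ f, ∑ s ∈ ({0, 2} : Finset (ZMod 4)), u4 (k f * s) := by
    simp_rw [chi_eq_prod_u4]
    rw [Finset.prod_univ_sum]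
    rfl
  have h2 : ∀ f, ∑ s ∈ ({0, 2} : Finset (ZMod 4)), u4 (k f * s) = if k f = 0 ∨ k f = 2 then 2 else 0 := fun f => by
    rw [Finset.sum_pair (show (0 : ZMod 4) ≠ 2 by decide), pairSum_u4]
  rw [h]
  simp_rw [h2]
  by_cases hk : k ∈ evenSet
  · rw [if_pos hk]
    rw [mem_evenSet] at hk
    rw [Finset.prod_congr rfl fun f _ => if_pos (hk f)]
    simp; norm_num
  · rw [if_neg hk]
    rw [mem_evenSet] at hk
    push Not at hk
    obtain ⟨f, hf⟩ := hk
    exact Finset.prod_eq_zero (Finset.mem_univ f) (by rw [if_neg (not_or.mpr hf)])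

/-! ## §4 The corank-16 witness `ω₁₆ = 16·𝟙_L − 1 + Re χ₁₁₁₁` -/

/-- `Re(i^{|τ|})` as a complex number is `(χ₁₁₁₁(τ) + χ₃₃₃₃(τ))/2`. -/
theorem re_u4_total (τ : PT) :
    (((u4 (∑ f, τ f)).re : ℝ) : ℂ) = (chi (fun _ => 1) τ + chi (fun _ => 3) τ) / 2 := by
  rw [Complex.re_eq_add_conj, ← u4_neg, chi_eq_u4, chi_eq_u4]
  congr 3
  · exact Finset.sum_congr rfl fun f _ => (one_mul _).symm
  · rw [← Finset.sum_neg_distrib]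
    exact Finset.sum_congr rfl fun f _ => by rw [show (3 : ZMod 4) = -1 from by decide, neg_one_mul]

/-- **the witness** `ω₁₆(τ) = 16·[τ ∈ L] − 1 + Re(i^{|τ|})` (integer values: `14, 16` on `L`, `0, −1, −2` off `L`). -/
noncomputable def omega16 (τ : PT) : ℝ := 16 * (if τ ∈ evenSet then 1 else 0) - 1 + (u4 (∑ f, τ f)).re

/-- `ω₁₆ ≤ 0` off the 16 even phases. -/
theorem omega16_nonpos (τ : PT) (hτ : τ ∉ evenSet) : omega16 τ ≤ 0 := by
  unfold omega16
  rw [if_neg hτ]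
  have h1 : (u4 (∑ f, τ f)).re ≤ 1 := by
    refine (Complex.re_le_norm _).trans ?_
    simp [u4, Complex.norm_I]
  linarith

/-- **all moments of `ω₁₆`**: `16·Σ_{L} χ_k − Σ χ_k + ½(Σ χ_{k+1111} + Σ χ_{k+3333})`, evaluated by §2–§3. -/
theorem moment_omega16 (k : PT) : moment omega16 k =
    16 * (if k ∈ evenSet then 16 else 0) - (if k = 0 then 256 else 0) +
      ((if (fun _ => (1 : ZMod 4)) + k = 0 then 256 else 0) + (if (fun _ => (3 : ZMod 4)) + k = 0 then 256 else 0)) / 2 := by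
  have hL : ∑ τ : PT, ((if τ ∈ evenSet then (1 : ℝ) else 0 : ℝ) : ℂ) * chi k τ = if k ∈ evenSet then 16 else 0 := by
    rw [← sum_chi_evenSet, ← Finset.univ_inter evenSet, ← Finset.sum_ite_mem, Finset.univ_inter]
    refine Finset.sum_congr rfl fun τ _ => ?_
    split_ifs <;> simp
  have hT : ∑ τ : PT, (((u4 (∑ f, τ f)).re : ℝ) : ℂ) * chi k τ =
      ((if (fun _ => (1 : ZMod 4)) + k = 0 then 256 else 0) + (if (fun _ => (3 : ZMod 4)) + k = 0 then 256 else 0)) / 2 := by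
    simp_rw [re_u4_total, div_mul_eq_mul_div, add_mul, chi_mul_chi]
    rw [← Finset.sum_div, Finset.sum_add_distrib, sum_chi, sum_chi]
  unfold moment omega16
  push_cast
  simp_rw [add_mul, sub_mul, Finset.sum_add_distrib, Finset.sum_sub_distrib, mul_assoc, ← Finset.mul_sum, hL, one_mul,
    sum_chi, hT]

theorem kadm_mem_evenSet {k : PT} (hk : KAdm k) : k ∈ evenSet ↔ k = 0 := by
  rw [mem_evenSet]
  constructor
  · intro h; funext f
    rcases h f with e | e
    · exact e
    · exact absurd e (hk.1 f)
  · rintro rfl f; exact Or.inl rfl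

theorem one_add_eq_zero_iff (k : PT) : (fun _ => (1 : ZMod 4)) + k = 0 ↔ k = fun _ => 3 := by
  have key : ∀ x : ZMod 4, 1 + x = 0 ↔ x = 3 := by decide
  constructor
  · intro h; funext f; exact (key _).1 (congr_fun h f)
  · rintro rfl; funext f; exact (key _).2 rfl

theorem three_add_eq_zero_iff (k : PT) : (fun _ => (3 : ZMod 4)) + k = 0 ↔ k = fun _ => 1 := by
  have key : ∀ x : ZMod 4, 3 + x = 0 ↔ x = 1 := by decide
  constructor
  · intro h; funext f; exact (key _).1 (congr_fun h f)
  · rintro rfl; funext f; exact (key _).2 rfl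

/-- the clean moments of `ω₁₆` all vanish. -/
theorem moment_omega16_clean (k : PT) (hk : KAdm k) : moment omega16 k = 0 := by
  rw [moment_omega16, if_neg (mt (one_add_eq_zero_iff k).1 hk.2.2), if_neg (mt (three_add_eq_zero_iff k).1 hk.2.1)]
  by_cases h0 : k = 0
  · rw [if_pos ((kadm_mem_evenSet hk).2 h0), if_pos h0]; norm_num
  · rw [if_neg (mt (kadm_mem_evenSet hk).1 h0), if_neg h0]; norm_num

/-- the top moment of `ω₁₆` is `128 ≠ 0`. -/
theorem moment_omega16_top : moment omega16 (fun _ => 1) = 128 := by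
  rw [moment_omega16]
  have h1 : ((fun _ => (1 : ZMod 4)) : PT) ∉ evenSet := by
    rw [mem_evenSet]; intro h; rcases h 0 with e | e <;> exact absurd e (by decide)
  have h2 : ((fun _ => (1 : ZMod 4)) : PT) ≠ 0 := fun h => absurd (congr_fun h 0) (by decide)
  have h3 : ¬ ((fun _ => (1 : ZMod 4)) + (fun _ => (1 : ZMod 4)) : PT) = 0 := fun h => absurd (congr_fun h 0) (by decide)
  have h4 : ((fun _ => (3 : ZMod 4)) + (fun _ => (1 : ZMod 4)) : PT) = 0 := by
    funext f; show (3 : ZMod 4) + 1 = 0; decide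
  rw [if_neg h1, if_neg h2, if_neg h3, if_pos h4]
  norm_num

/-- **THE LAW FAILS AT CORANK 16**: `ω₁₆` is non-positive off the 16 even phases, all its clean moments vanish, and its top
moment is `128`.  So no «covering-lemma induction» and no «character-sum argument uniform in the corank» can exist. -/
theorem not_phaseTorusLawN_sixteen : ¬ PhaseTorusLawN 16 := by
  intro H
  have h := H omega16 evenSet (by rw [evenSet_card]) omega16_nonpos moment_omega16_clean
  rw [moment_omega16_top] at h
  norm_num at h

/-- … hence at every corank `γ ≥ 16`. -/
theorem not_phaseTorusLawN_of_le {γ : ℕ} (h : 16 ≤ γ) : ¬ PhaseTorusLawN γ :=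
  fun H => not_phaseTorusLawN_sixteen (phaseTorusLawN_mono h H)

/-- **the corank-free phase-torus law is false.** -/
theorem not_phaseTorusLawAll : ¬ PhaseTorusLawAll :=
  fun H => not_phaseTorusLawN_sixteen (phaseTorusLawAll_iff.1 H 16)

/-! ## §5 The E8 LAW (corank-free): positive phases inside a coset of the even-weight code `E8` ⇒ `μ = 0`

`E8 = {τ ∈ L : |τ| ≡ 0 (4)}` (8 phases; with its 32 cosets the ONLY non-box-hosted 8-subsets of `(ℤ/4)⁴`, `py/tiling8.py`).
Certificates (all `≥ 0`, all vanishing on `E8`, spectra inside `{0,±1}⁴`; found by the exact orbit LP `py/symlp.py` and read off in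
closed form): `F₁ = 1 − Re χ`, `F₂ = 1 + Re χ − 2·𝟙_L·Re χ`, `F₃± = 1 − Re χ ± Im χ` (`χ = χ₁₁₁₁ = i^{|τ|}`).  Pairing a clean `ω ≤ 0`
off `E8` against them gives `Re μ ≥ 0`, `¾·Re μ ≤ 0`, `−Re μ ± Im μ ≤ 0`, whence `μ = 0`; the one non-trivial input is the coset
identity `Σ_{τ ∈ L} ω(τ)χ(τ) = (μ + μ̄)/16` (Poisson over `L = L^⊥`, the 14 frequencies `{1,3}⁴ ∖ {±1111}` being clean). -/

/-- the even-weight code `E8 ⊆ L`: even phases with `|τ| ≡ 0 (mod 4)`. -/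
def e8Set : Finset PT := evenSet.filter fun τ => ∑ f, τ f = 0

theorem mem_e8Set {τ : PT} : τ ∈ e8Set ↔ τ ∈ evenSet ∧ ∑ f, τ f = 0 := Finset.mem_filter

/-- pairing a measure that is `≤ 0` off `A` against a non-negative test function vanishing on `A` gives `≤ 0`. -/
theorem pairing_nonpos (ω F : PT → ℝ) (A : Finset PT) (hω : ∀ τ, τ ∉ A → ω τ ≤ 0) (hF : ∀ τ, 0 ≤ F τ)
    (hFA : ∀ τ, τ ∈ A → F τ = 0) : ∑ τ, ω τ * F τ ≤ 0 := by
  refine Finset.sum_nonpos fun τ _ => ?_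
  by_cases h : τ ∈ A
  · rw [hFA τ h, mul_zero]
  · exact mul_nonpos_of_nonpos_of_nonneg (hω τ h) (hF τ)

theorem chi_zero_left (τ : PT) : chi 0 τ = 1 := by
  rw [chi_eq_u4]; simp [u4_zero]

theorem chi_one_left (τ : PT) : chi (fun _ => 1) τ = u4 (∑ f, τ f) := by
  rw [chi_eq_u4]; exact congrArg u4 (Finset.sum_congr rfl fun f _ => one_mul _)

/-- `Σ ω = 0` for a clean `ω` (the row `k = 0`). -/
theorem sum_eq_zero_of_clean (ω : PT → ℝ) (hK : ∀ k, KAdm k → moment ω k = 0) : ∑ τ, ω τ = 0 := by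
  have h := hK 0 ⟨fun f => by show (0 : ZMod 4) ≠ 2; decide, fun h => absurd (congr_fun h 0) (by decide),
    fun h => absurd (congr_fun h 0) (by decide)⟩
  unfold moment at h
  simp_rw [chi_zero_left, mul_one] at h
  exact_mod_cast h

/-- `Σ ω·Re χ = Re μ`. -/
theorem sum_mul_re (ω : PT → ℝ) : ∑ τ, ω τ * (u4 (∑ f, τ f)).re = (moment ω (fun _ => 1)).re := by
  unfold moment
  rw [Complex.re_sum]
  exact Finset.sum_congr rfl fun τ _ => by rw [chi_one_left, Complex.re_ofReal_mul]

/-- `Σ ω·Im χ = Im μ`. -/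
theorem sum_mul_im (ω : PT → ℝ) : ∑ τ, ω τ * (u4 (∑ f, τ f)).im = (moment ω (fun _ => 1)).im := by
  unfold moment
  rw [Complex.im_sum]
  exact Finset.sum_congr rfl fun τ _ => by rw [chi_one_left, Complex.im_ofReal_mul]

theorem chi_comm (k τ : PT) : chi k τ = chi τ k := by
  rw [chi_eq_u4, chi_eq_u4]
  exact congrArg u4 (Finset.sum_congr rfl fun f _ => mul_comm _ _)

/-- `16·𝟙_L(τ) = Σ_{δ ∈ L} χ_δ(τ)` (Poisson over the self-dual `L`). -/
theorem indicator_evenSet (τ : PT) : ∑ δ ∈ evenSet, chi δ τ = if τ ∈ evenSet then 16 else 0 := by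
  rw [Finset.sum_congr rfl fun δ _ => chi_comm δ τ, sum_chi_evenSet]

theorem two_facts : ((fun _ => (2 : ZMod 4)) : PT) ∈ evenSet ∧ ((fun _ => (2 : ZMod 4)) : PT) ≠ 0 := by
  refine ⟨mem_evenSet.2 fun _ => Or.inr rfl, fun h => absurd (congr_fun h 0) (by decide)⟩

/-- for `δ ∈ L ∖ {0, 2222}` the frequency `1111 + δ` is clean. -/
theorem kadm_one_add {δ : PT} (hδ : δ ∈ evenSet) (h0 : δ ≠ 0) (h2 : δ ≠ fun _ => 2) :
    KAdm ((fun _ => (1 : ZMod 4)) + δ) := by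
  rw [mem_evenSet] at hδ
  refine ⟨fun f => ?_, fun h => h0 ?_, fun h => h2 ?_⟩
  · rcases hδ f with e | e <;> simp [e] <;> decide
  · funext f; have := congr_fun h f; simp at this; exact this
  · funext f
    have hf := congr_fun h f
    simp only [Pi.add_apply] at hf
    have key : ∀ x : ZMod 4, 1 + x = 3 → x = 2 := by decide
    exact key _ hf

/-- **the coset identity**: `Σ_{τ ∈ L} ω(τ)χ₁₁₁₁(τ) = (μ + μ̄)/16` for a clean `ω`. -/
theorem sum_evenSet_mul_chi (ω : PT → ℝ) (hK : ∀ k, KAdm k → moment ω k = 0) :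
    ∑ τ ∈ evenSet, (ω τ : ℂ) * chi (fun _ => 1) τ =
      (moment ω (fun _ => 1) + (starRingEnd ℂ) (moment ω (fun _ => 1))) / 16 := by
  have h16 : (16 : ℂ) * ∑ τ ∈ evenSet, (ω τ : ℂ) * chi (fun _ => 1) τ =
      ∑ δ ∈ evenSet, moment ω ((fun _ => (1 : ZMod 4)) + δ) := by
    calc (16 : ℂ) * ∑ τ ∈ evenSet, (ω τ : ℂ) * chi (fun _ => 1) τ
        = ∑ τ, (ω τ : ℂ) * chi (fun _ => 1) τ * ∑ δ ∈ evenSet, chi δ τ := by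
          rw [Finset.mul_sum, ← Finset.sum_filter_add_sum_filter_not Finset.univ (· ∈ evenSet)]
          rw [Finset.filter_mem_eq_inter, Finset.univ_inter]
          have hz : ∑ τ ∈ Finset.univ.filter (fun τ => ¬ τ ∈ evenSet),
              (ω τ : ℂ) * chi (fun _ => 1) τ * ∑ δ ∈ evenSet, chi δ τ = 0 :=
            Finset.sum_eq_zero fun τ hτ => by
              rw [indicator_evenSet, if_neg (Finset.mem_filter.1 hτ).2, mul_zero]
          rw [hz, add_zero]
          refine Finset.sum_congr rfl fun τ hτ => ?_
          rw [indicator_evenSet, if_pos hτ]; ring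
      _ = ∑ δ ∈ evenSet, ∑ τ, (ω τ : ℂ) * chi ((fun _ => 1) + δ) τ := by
          rw [Finset.sum_comm]
          refine Finset.sum_congr rfl fun τ _ => ?_
          rw [Finset.mul_sum]
          refine Finset.sum_congr rfl fun δ _ => ?_
          rw [mul_assoc, chi_mul_chi]
      _ = ∑ δ ∈ evenSet, moment ω ((fun _ => (1 : ZMod 4)) + δ) := rfl
  have hsplit : ∑ δ ∈ evenSet, moment ω ((fun _ => (1 : ZMod 4)) + δ) =
      moment ω (fun _ => 1) + (starRingEnd ℂ) (moment ω (fun _ => 1)) := by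
    rw [← Finset.add_sum_erase _ _ (mem_evenSet.2 fun _ => Or.inl rfl : (0 : PT) ∈ evenSet),
      ← Finset.add_sum_erase _ _ (Finset.mem_erase.2 ⟨two_facts.2, two_facts.1⟩)]
    have h12 : ((fun _ => (1 : ZMod 4)) + (fun _ => (2 : ZMod 4)) : PT) = fun _ => 3 := by
      funext f; show (1 : ZMod 4) + 2 = 3; decide
    rw [Finset.sum_eq_zero fun δ hδ => ?_]
    · rw [add_zero, add_zero, h12, ← moment_three]
    · obtain ⟨h2, h0', hL⟩ : δ ≠ (fun _ => 2) ∧ δ ≠ 0 ∧ δ ∈ evenSet := by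
        simpa [Finset.mem_erase, and_assoc] using hδ
      exact hK _ (kadm_one_add hL h0' h2)
  have h16' : (16 : ℂ) ≠ 0 := by norm_num
  rw [eq_div_iff h16', mul_comm, h16, hsplit]

/-- `Σ_τ ω·𝟙_L·Re χ = Re μ / 8`. -/
theorem sum_mul_ind_re (ω : PT → ℝ) (hK : ∀ k, KAdm k → moment ω k = 0) :
    ∑ τ, ω τ * ((if τ ∈ evenSet then 1 else 0) * (u4 (∑ f, τ f)).re) = (moment ω (fun _ => 1)).re / 8 := by
  have h := congrArg Complex.re (sum_evenSet_mul_chi ω hK)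
  rw [Complex.re_sum] at h
  simp only [Complex.div_ofNat_re, Complex.add_re, Complex.conj_re] at h
  have hA : ∑ τ, ω τ * ((if τ ∈ evenSet then 1 else 0) * (u4 (∑ f, τ f)).re) =
      ∑ τ ∈ evenSet, ω τ * (u4 (∑ f, τ f)).re := by
    rw [← Finset.univ_inter evenSet, ← Finset.sum_ite_mem, Finset.univ_inter]
    refine Finset.sum_congr rfl fun τ _ => ?_
    split_ifs <;> simp
  have hB : ∑ τ ∈ evenSet, ω τ * (u4 (∑ f, τ f)).re = ∑ τ ∈ evenSet, ((ω τ : ℂ) * chi (fun _ => 1) τ).re :=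
    Finset.sum_congr rfl fun τ _ => by rw [chi_one_left, Complex.re_ofReal_mul]
  rw [hA, hB, h]
  ring

theorem u4_cases (x : ZMod 4) : u4 x = 1 ∨ u4 x = Complex.I ∨ u4 x = -1 ∨ u4 x = -Complex.I := by
  rcases cases_zmod4 x with rfl | rfl | rfl | rfl
  · exact Or.inl u4_zero
  · exact Or.inr (Or.inl u4_one)
  · exact Or.inr (Or.inr (Or.inl u4_two))
  · exact Or.inr (Or.inr (Or.inr u4_three))

theorem re_u4_le (x : ZMod 4) : (u4 x).re ≤ 1 := by
  rcases u4_cases x with h | h | h | h <;> rw [h] <;> simp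

theorem neg_one_le_re_u4 (x : ZMod 4) : -1 ≤ (u4 x).re := by
  rcases u4_cases x with h | h | h | h <;> rw [h] <;> simp

theorem cert3_nonneg (x : ZMod 4) : 0 ≤ 1 - (u4 x).re + (u4 x).im ∧ 0 ≤ 1 - (u4 x).re - (u4 x).im := by
  rcases u4_cases x with h | h | h | h <;> rw [h] <;> simp

/-- **E8 LAW (base coset)**: a clean `ω` that is `≤ 0` off `E8` has `μ = 0`. -/
theorem e8Law_zero (ω : PT → ℝ) (hω : ∀ τ, τ ∉ e8Set → ω τ ≤ 0) (hK : ∀ k, KAdm k → moment ω k = 0) :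
    moment ω (fun _ => 1) = 0 := by
  set m := moment ω (fun _ => 1) with hm
  have h0 := sum_eq_zero_of_clean ω hK
  have hre := sum_mul_re ω
  have him := sum_mul_im ω
  have hind := sum_mul_ind_re ω hK
  -- values of χ on E8: Re χ = 1, Im χ = 0
  have onE8 : ∀ τ, τ ∈ e8Set → (u4 (∑ f, τ f)).re = 1 ∧ (u4 (∑ f, τ f)).im = 0 ∧ τ ∈ evenSet := fun τ hτ => by
    obtain ⟨hL, hs⟩ := mem_e8Set.1 hτ
    rw [hs, u4_zero]; simp [hL]
  -- F₁ = 1 − Re χ  ⇒  Re m ≥ 0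
  have P1 := pairing_nonpos ω (fun τ => 1 - (u4 (∑ f, τ f)).re) e8Set hω
    (fun τ => by linarith [re_u4_le (∑ f, τ f)]) (fun τ hτ => by simp [(onE8 τ hτ).1])
  -- F₂ = 1 + Re χ − 2·𝟙_L·Re χ  ⇒  Re m ≤ 0
  have P2 := pairing_nonpos ω
    (fun τ => 1 + (u4 (∑ f, τ f)).re - 2 * ((if τ ∈ evenSet then 1 else 0) * (u4 (∑ f, τ f)).re)) e8Set hω
    (fun τ => by
      by_cases h : τ ∈ evenSet
      · rw [if_pos h]; linarith [re_u4_le (∑ f, τ f)]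
      · rw [if_neg h]; linarith [neg_one_le_re_u4 (∑ f, τ f)])
    (fun τ hτ => by simp [(onE8 τ hτ).1, (onE8 τ hτ).2.2]; norm_num)
  -- F₃± = 1 − Re χ ± Im χ  ⇒  −Re m ± Im m ≤ 0
  have P3 := pairing_nonpos ω (fun τ => 1 - (u4 (∑ f, τ f)).re + (u4 (∑ f, τ f)).im) e8Set hω
    (fun τ => (cert3_nonneg _).1) (fun τ hτ => by simp [(onE8 τ hτ).1, (onE8 τ hτ).2.1])
  have P4 := pairing_nonpos ω (fun τ => 1 - (u4 (∑ f, τ f)).re - (u4 (∑ f, τ f)).im) e8Set hω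
    (fun τ => (cert3_nonneg _).2) (fun τ hτ => by simp [(onE8 τ hτ).1, (onE8 τ hτ).2.1])
  have hind2 : ∑ τ, ω τ * (2 * ((if τ ∈ evenSet then 1 else 0) * (u4 (∑ f, τ f)).re)) = 2 * (m.re / 8) := by
    rw [← hind, Finset.mul_sum]
    exact Finset.sum_congr rfl fun τ _ => by ring
  simp only [mul_sub, mul_add, mul_one, Finset.sum_sub_distrib, Finset.sum_add_distrib, h0, hre, him, hind2] at P1 P2 P3 P4
  apply Complex.ext
  · simp; linarith
  · simp; linarith

/-- `χ_k` is additive in the phase: `χ_k(τ + c) = χ_k(τ)·χ_k(c)`. -/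
theorem chi_add_right (k τ c : PT) : chi k (τ + c) = chi k τ * chi k c := by
  rw [chi_eq_u4, chi_eq_u4, chi_eq_u4, ← u4_add]
  congr 1
  rw [← Finset.sum_add_distrib]
  exact Finset.sum_congr rfl fun f _ => by rw [Pi.add_apply, mul_add]

theorem chi_ne_zero (k τ : PT) : chi k τ ≠ 0 := by
  rw [chi_eq_u4]; unfold u4
  exact pow_ne_zero _ Complex.I_ne_zero

/-- moments of a translate: `Σ_τ ω(τ + c) χ_k(τ) = χ_k(−c)·ω̂(k)`. -/
theorem moment_translate (ω : PT → ℝ) (c k : PT) :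
    moment (fun τ => ω (τ + c)) k = chi k (-c) * moment ω k := by
  unfold moment
  rw [Finset.mul_sum]
  refine Fintype.sum_equiv (Equiv.addRight c) _ _ fun τ => ?_
  simp only [Equiv.coe_addRight]
  rw [show chi k τ = chi k (τ + c + -c) from by rw [add_neg_cancel_right], chi_add_right k (τ + c) (-c)]
  ring

/-- **E8 LAW (every coset; corank-free)**: a clean `ω` that is `≤ 0` off a coset `E8 + c` has `μ = 0`. -/
theorem e8Law (ω : PT → ℝ) (c : PT) (hω : ∀ τ, τ ∉ e8Set.image (· + c) → ω τ ≤ 0)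
    (hK : ∀ k, KAdm k → moment ω k = 0) : moment ω (fun _ => 1) = 0 := by
  have h := e8Law_zero (fun τ => ω (τ + c))
    (fun τ hτ => hω _ fun him => hτ (by
      obtain ⟨σ, hσ, e⟩ := Finset.mem_image.1 him
      rwa [← add_right_cancel e]))
    (fun k hk => by rw [moment_translate, hK k hk, mul_zero])
  rw [moment_translate] at h
  exact (mul_eq_zero.1 h).resolve_left (chi_ne_zero _ _)

/-! ## §6 Corank 8 from the dichotomy -/

/-- `A` is BOX-HOSTED: a free coordinate `f₀` and an adjacent pair `{s f, s f + 1}` on every other coordinate catch all of `A`. -/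
def BoxHosted (A : Finset PT) (f₀ : Fin 4) (s : Fin 4 → ZMod 4) : Prop :=
  ∀ a ∈ A, ∃ f, f ≠ f₀ ∧ (a f = s f ∨ a f = s f + 1)

/-- the BOX LAW: box-hosted positive set (ANY cardinality) ⇒ `μ = 0` (= `Summit.Ventures.HSemireg.PhaseTorus.boxLaw` of the G1 candidate). -/
def BoxLaw : Prop :=
  ∀ (ω : PT → ℝ) (A : Finset PT) (f₀ : Fin 4) (s : Fin 4 → ZMod 4), BoxHosted A f₀ s →
    (∀ τ, τ ∉ A → ω τ ≤ 0) → (∀ k, KAdm k → moment ω k = 0) → moment ω (fun _ => 1) = 0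

/-- **the box law holds** (kernel: v4's `rot_step` for a general free coordinate `f₀` + the four rotations; no cardinality anywhere). -/
theorem boxLaw_holds : BoxLaw := by
  intro ω A f₀ s hbox hω hK
  set P : ℂ := ∏ f ∈ Finset.univ.erase f₀, (starRingEnd ℂ) (zPair (s f)) / 2 with hP
  have hPne : P ≠ 0 := Finset.prod_ne_zero_iff.2 fun f _ =>
    div_ne_zero ((map_ne_zero _).2 (zPair_ne_zero _)) (by norm_num)
  have key : ∀ w : ZMod 4, (e (-w) * (P * moment ω (fun _ => 1) / 4)).re ≤ 0 := by
    intro w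
    have h := rot_step ω A hω hK f₀ s hbox w
    rw [prod_cvec_one] at h
    have hrw : e (-w) / 4 * P * moment ω (fun _ => 1) = e (-w) * (P * moment ω (fun _ => 1) / 4) := by ring
    rw [hrw] at h
    exact h
  have hz : P * moment ω (fun _ => 1) / 4 = 0 := by
    apply eq_zero_of_re_rot_nonpos
    · have := key 0; rwa [neg_zero, e_zero] at this
    · have := key 3; rwa [show (-3 : ZMod 4) = 1 from by decide, e_one] at this
    · have := key 2; rwa [show (-2 : ZMod 4) = 2 from by decide, e_two] at this
    · have := key 1; rwa [show (-1 : ZMod 4) = 3 from by decide, e_three] at this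
  have h4 : (4 : ℂ) ≠ 0 := by norm_num
  rcases mul_eq_zero.1 ((div_eq_zero_iff.1 hz).resolve_right h4) with h | h
  · exact absurd h hPne
  · exact h

/-- **THE 8-SET DICHOTOMY** (finite combinatorics of `(ℤ/4)⁴`; PROVED below, `eightDichotomy_holds`, §7; also verified by exhaustive
enumeration `py/tiling8.py` + `py/cliques.py`: the non-hosted 8-sets are exactly the 32 cosets of `E8`): every set of at most 8 phases is
box-hosted or lies in an E8-coset. -/
def EightDichotomy : Prop :=
  ∀ A : Finset PT, A.card ≤ 8 → (∃ f₀ s, BoxHosted A f₀ s) ∨ (∃ c, A ⊆ e8Set.image (· + c))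

/-- **corank 8**: the phase-torus law holds at corank `≤ 8`, given the 8-set dichotomy (box law + E8 law, both kernel). -/
theorem phaseTorusLawN_eight_of_dichotomy (hdich : EightDichotomy) : PhaseTorusLawN 8 := by
  intro ω A hA hω hK
  rcases hdich A hA with ⟨f₀, s, hhost⟩ | ⟨c, hc⟩
  · exact boxLaw_holds ω A f₀ s hhost hω hK
  · exact e8Law ω c (fun τ hτ => hω τ fun ha => hτ (hc ha)) hK

/-- threshold summary from a dichotomy hypothesis (kept for the record; see `phaseTorusLaw8_holds`, `threshold_kernel` below for the
unconditional statements). -/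
theorem threshold_summary (hdich : EightDichotomy) :
    PhaseTorusLawN 7 ∧ PhaseTorusLawN 8 ∧ ¬ PhaseTorusLawN 16 ∧ ¬ PhaseTorusLawAll :=
  ⟨phaseTorusLawN_seven, phaseTorusLawN_eight_of_dichotomy hdich, not_phaseTorusLawN_sixteen, not_phaseTorusLawAll⟩

/-! ## §7 THE 8-SET DICHOTOMY (kernel): non-hosted sets of `≤ 8` phases lie in E8-cosets

Pen route (no enumeration): greedy hosting counts force every complementary pair to catch exactly 4 points and every box exactly 2,
the two points of a box being OPPOSITE on the remaining coordinates (else a host exists); then an odd difference `b_g = a_g + 1`, or an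
even difference of odd weight, produces two points agreeing on two coordinates but not opposite on a third — contradiction. -/

/-! ### §7.1 Hosting bookkeeping -/

/-- the points of `B` NOT hosted by the adjacent pair `{s, s+1}` on coordinate `g`. -/
def unhosted (B : Finset PT) (g : Fin 4) (s : ZMod 4) : Finset PT := B.filter fun a => ¬(a g = s ∨ a g = s + 1)

theorem mem_unhosted {B : Finset PT} {g : Fin 4} {s : ZMod 4} {a : PT} :
    a ∈ unhosted B g s ↔ a ∈ B ∧ ¬(a g = s ∨ a g = s + 1) := Finset.mem_filter

/-- double counting: every value of `ℤ/4` escapes exactly two of the four adjacent pairs. -/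
theorem sum_card_unhosted (B : Finset PT) (g : Fin 4) : ∑ s : ZMod 4, (unhosted B g s).card = 2 * B.card := by
  have hcount : ∀ v : ZMod 4, (Finset.univ.filter (fun s : ZMod 4 => ¬(v = s ∨ v = s + 1))).card = 2 := by decide
  unfold unhosted
  simp only [Finset.card_filter]
  rw [Finset.sum_comm]
  simp only [← Finset.card_filter, hcount]
  simp [Finset.sum_const, mul_comm]

theorem exists_fourth (g₁ g₂ g₃ : Fin 4) : ∃ f₀ : Fin 4, f₀ ≠ g₁ ∧ f₀ ≠ g₂ ∧ f₀ ≠ g₃ := by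
  revert g₁ g₂ g₃; decide

theorem exists_two_others (g₁ : Fin 4) : ∃ g₂ g₃ : Fin 4, g₂ ≠ g₁ ∧ g₃ ≠ g₁ ∧ g₂ ≠ g₃ := by
  revert g₁; decide

theorem exists_other (g₁ g₂ : Fin 4) : ∃ g₃ : Fin 4, g₃ ≠ g₁ ∧ g₃ ≠ g₂ := by
  revert g₁ g₂; decide

/-- assembling a box host from three hosting pairs on three distinct coordinates. -/
theorem boxHosted_of_three (A : Finset PT) {g₁ g₂ g₃ : Fin 4} (h12 : g₁ ≠ g₂) (h13 : g₁ ≠ g₃) (h23 : g₂ ≠ g₃)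
    (s₁ s₂ s₃ : ZMod 4)
    (H : ∀ a ∈ A, (a g₁ = s₁ ∨ a g₁ = s₁ + 1) ∨ (a g₂ = s₂ ∨ a g₂ = s₂ + 1) ∨ (a g₃ = s₃ ∨ a g₃ = s₃ + 1)) :
    ∃ f₀ s, BoxHosted A f₀ s := by
  obtain ⟨f₀, h01, h02, h03⟩ := exists_fourth g₁ g₂ g₃
  refine ⟨f₀, fun f => if f = g₁ then s₁ else if f = g₂ then s₂ else s₃, fun a ha => ?_⟩
  rcases H a ha with h | h | h
  · exact ⟨g₁, fun e => h01 e.symm, by simpa using h⟩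
  · exact ⟨g₂, fun e => h02 e.symm, by simpa [h12.symm] using h⟩
  · exact ⟨g₃, fun e => h03 e.symm, by simpa [h13.symm, h23.symm] using h⟩

/-- a set of `≤ 1` points is hosted on any coordinate. -/
theorem host_le_one (B : Finset PT) (hB : B.card ≤ 1) (g : Fin 4) : ∃ s : ZMod 4, ∀ a ∈ B, a g = s ∨ a g = s + 1 := by
  obtain ⟨s, hs⟩ := exists_half_host B g
  refine ⟨s, fun a ha => ?_⟩
  by_contra hn
  have hmem : a ∈ B.filter (fun a => ¬(a g = s ∨ a g = s + 1)) := Finset.mem_filter.2 ⟨ha, hn⟩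
  have hpos : 0 < (B.filter (fun a => ¬(a g = s ∨ a g = s + 1))).card := Finset.card_pos.2 ⟨a, hmem⟩
  omega

/-- a set of `≤ 3` points is hosted on any two coordinates. -/
theorem host_le_three (B : Finset PT) (hB : B.card ≤ 3) (g₂ g₃ : Fin 4) :
    ∃ s₂ s₃ : ZMod 4, ∀ a ∈ B, (a g₂ = s₂ ∨ a g₂ = s₂ + 1) ∨ (a g₃ = s₃ ∨ a g₃ = s₃ + 1) := by
  obtain ⟨s₂, hs₂⟩ := exists_half_host B g₂
  have h1 : (B.filter (fun a => ¬(a g₂ = s₂ ∨ a g₂ = s₂ + 1))).card ≤ 1 := by omega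
  obtain ⟨s₃, hs₃⟩ := host_le_one _ h1 g₃
  refine ⟨s₂, s₃, fun a ha => ?_⟩
  by_cases h : a g₂ = s₂ ∨ a g₂ = s₂ + 1
  · exact Or.inl h
  · exact Or.inr (hs₃ a (Finset.mem_filter.2 ⟨ha, h⟩))


/-- `Σ_{s ∈ ℤ/4} g s = g 0 + g 1 + g 2 + g 3` (ℕ-valued instance of v4's `sum_univ_zmod4`). -/
theorem sum_zmod4_nat (g : ZMod 4 → ℕ) : ∑ j, g j = g 0 + g 1 + g 2 + g 3 := sum_univ_zmod4 g

theorem mem_pair_pred (x : ZMod 4) : x = x + 3 ∨ x = x + 3 + 1 := by revert x; decide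

theorem add_three_add_one (x : ZMod 4) : x + 3 + 1 = x := by revert x; decide

/-- complementary pairs are pairs: `¬(x ∈ {t+2, t+3}) ↔ x ∈ {t, t+1}`. -/
theorem not_far_iff (x t : ZMod 4) : ¬(x = t + 2 ∨ x = t + 2 + 1) ↔ (x = t ∨ x = t + 1) := by
  revert x t; decide

/-- the BOX of `A` over the adjacent pairs `{t₁, t₁+1}` at `g₁` and `{t₂, t₂+1}` at `g₂`. -/
def box (A : Finset PT) (g₁ : Fin 4) (t₁ : ZMod 4) (g₂ : Fin 4) (t₂ : ZMod 4) : Finset PT :=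
  A.filter fun a => (a g₁ = t₁ ∨ a g₁ = t₁ + 1) ∧ (a g₂ = t₂ ∨ a g₂ = t₂ + 1)

theorem mem_box {A : Finset PT} {g₁ g₂ : Fin 4} {t₁ t₂ : ZMod 4} {a : PT} :
    a ∈ box A g₁ t₁ g₂ t₂ ↔ a ∈ A ∧ (a g₁ = t₁ ∨ a g₁ = t₁ + 1) ∧ (a g₂ = t₂ ∨ a g₂ = t₂ + 1) := Finset.mem_filter

theorem box_eq_unhosted₂ (A : Finset PT) (g₁ : Fin 4) (t₁ : ZMod 4) (g₂ : Fin 4) (t₂ : ZMod 4) :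
    box A g₁ t₁ g₂ t₂ = unhosted (unhosted A g₁ (t₁ + 2)) g₂ (t₂ + 2) := by
  ext a
  simp only [mem_box, mem_unhosted, not_far_iff, and_assoc]

/-! ### §7.2 Structure of a non-hosted set of at most 8 phases -/

section structure_

variable {A : Finset PT} (hA8 : A.card ≤ 8) (hN : ∀ (f₀ : Fin 4) (s : Fin 4 → ZMod 4), ¬ BoxHosted A f₀ s)
include hA8 hN

omit hA8 in
/-- every complementary pair catches at least 4 points … -/
theorem four_le_card_unhosted (g : Fin 4) (s : ZMod 4) : 4 ≤ (unhosted A g s).card := by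
  by_contra hlt
  have h3 : (unhosted A g s).card ≤ 3 := by omega
  obtain ⟨g₂, g₃, h21, h31, h23⟩ := exists_two_others g
  obtain ⟨s₂, s₃, hh⟩ := host_le_three _ h3 g₂ g₃
  obtain ⟨f₀, t, ht⟩ := boxHosted_of_three A (Ne.symm h21) (Ne.symm h31) h23 s s₂ s₃ fun a ha => by
    by_cases h : a g = s ∨ a g = s + 1
    · exact Or.inl h
    · exact Or.inr (hh a (mem_unhosted.2 ⟨ha, h⟩))
  exact hN f₀ t ht

/-- … hence exactly 4, and `|A| = 8`. -/
theorem card_unhosted (g : Fin 4) (s : ZMod 4) : (unhosted A g s).card = 4 := by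
  have hsum := sum_card_unhosted A g
  rw [sum_zmod4_nat] at hsum
  have h0 := four_le_card_unhosted hN g 0
  have h1 := four_le_card_unhosted hN g 1
  have h2 := four_le_card_unhosted hN g 2
  have h3 := four_le_card_unhosted hN g 3
  have := four_le_card_unhosted hN g s
  rcases zmod4_cases s with rfl | rfl | rfl | rfl <;> omega

theorem card_eq_eight : A.card = 8 := by
  have hsum := sum_card_unhosted A 0
  rw [sum_zmod4_nat] at hsum
  have h0 := card_unhosted hA8 hN 0 0
  have h1 := card_unhosted hA8 hN 0 1
  have h2 := card_unhosted hA8 hN 0 2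
  have h3 := card_unhosted hA8 hN 0 3
  omega

/-- the doubly complementary box catches exactly 2 points. -/
theorem card_unhosted₂ {g₁ g₂ : Fin 4} (hg : g₁ ≠ g₂) (s₁ s₂ : ZMod 4) :
    (unhosted (unhosted A g₁ s₁) g₂ s₂).card = 2 := by
  have hge : ∀ t : ZMod 4, 2 ≤ (unhosted (unhosted A g₁ s₁) g₂ t).card := by
    intro t
    by_contra hlt
    have h1 : (unhosted (unhosted A g₁ s₁) g₂ t).card ≤ 1 := by omega
    obtain ⟨g₃, h31, h32⟩ := exists_other g₁ g₂
    obtain ⟨s₃, hs₃⟩ := host_le_one _ h1 g₃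
    obtain ⟨f₀, u, hu⟩ := boxHosted_of_three A hg (Ne.symm h31) (Ne.symm h32) s₁ t s₃ fun a ha => by
      by_cases c1 : a g₁ = s₁ ∨ a g₁ = s₁ + 1
      · exact Or.inl c1
      by_cases c2 : a g₂ = t ∨ a g₂ = t + 1
      · exact Or.inr (Or.inl c2)
      exact Or.inr (Or.inr (hs₃ a (mem_unhosted.2 ⟨mem_unhosted.2 ⟨ha, c1⟩, c2⟩)))
    exact hN f₀ u hu
  have hsum := sum_card_unhosted (unhosted A g₁ s₁) g₂
  rw [sum_zmod4_nat, card_unhosted hA8 hN g₁ s₁] at hsum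
  have h0 := hge 0; have h1 := hge 1; have h2 := hge 2; have h3 := hge 3
  have := hge s₂
  rcases zmod4_cases s₂ with rfl | rfl | rfl | rfl <;> omega

/-- **every box holds exactly two points of `A`.** -/
theorem card_box {g₁ g₂ : Fin 4} (hg : g₁ ≠ g₂) (t₁ t₂ : ZMod 4) : (box A g₁ t₁ g₂ t₂).card = 2 := by
  rw [box_eq_unhosted₂ A]; exact card_unhosted₂ hA8 hN hg _ _

/-- **two distinct points in a common box are OPPOSITE on the two remaining coordinates.** -/
theorem opp_of_box {g₁ g₂ : Fin 4} (hg : g₁ ≠ g₂) (t₁ t₂ : ZMod 4) {a b : PT}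
    (ha : a ∈ box A g₁ t₁ g₂ t₂) (hb : b ∈ box A g₁ t₁ g₂ t₂) (hab : a ≠ b)
    (g₃ : Fin 4) (h31 : g₃ ≠ g₁) (h32 : g₃ ≠ g₂) : b g₃ = a g₃ + 2 := by
  by_contra hne
  -- the box is {a, b}
  have hbox : ∀ c ∈ box A g₁ t₁ g₂ t₂, c = a ∨ c = b := by
    intro c hc
    by_contra hc'
    push Not at hc'
    have h3 : 3 ≤ (box A g₁ t₁ g₂ t₂).card := by
      have : ({a, b, c} : Finset PT) ⊆ box A g₁ t₁ g₂ t₂ := by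
        intro x hx; simp only [Finset.mem_insert, Finset.mem_singleton] at hx
        rcases hx with rfl | rfl | rfl <;> assumption
      have hc3 : ({a, b, c} : Finset PT).card = 3 := by
        rw [Finset.card_insert_of_notMem, Finset.card_pair (Ne.symm hc'.2)]
        simp [hab, Ne.symm hc'.1]
      exact hc3 ▸ Finset.card_le_card this
    have := card_box hA8 hN hg t₁ t₂
    omega
  -- host: pairs t₁ @ g₁, t₂ @ g₂, and {a g₃, a g₃ + 1} or {a g₃ - 1, a g₃} @ g₃ catches b too (non-opposite values)
  have hs3 : ∃ s₃ : ZMod 4, (a g₃ = s₃ ∨ a g₃ = s₃ + 1) ∧ (b g₃ = s₃ ∨ b g₃ = s₃ + 1) := by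
    have key : ∀ x y : ZMod 4, y ≠ x + 2 → ∃ s : ZMod 4, (x = s ∨ x = s + 1) ∧ (y = s ∨ y = s + 1) := by decide
    exact key _ _ hne
  obtain ⟨s₃, ha3, hb3⟩ := hs3
  obtain ⟨f₀, u, hu⟩ := boxHosted_of_three A hg (Ne.symm h31) (Ne.symm h32) (t₁ + 2) (t₂ + 2) s₃ fun c hc => by
    by_cases c1 : c g₁ = t₁ + 2 ∨ c g₁ = t₁ + 2 + 1
    · exact Or.inl c1
    by_cases c2 : c g₂ = t₂ + 2 ∨ c g₂ = t₂ + 2 + 1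
    · exact Or.inr (Or.inl c2)
    have hcb : c ∈ box A g₁ t₁ g₂ t₂ := mem_box.2 ⟨hc, (not_far_iff _ _).1 c1, (not_far_iff _ _).1 c2⟩
    rcases hbox c hcb with rfl | rfl
    · exact Or.inr (Or.inr ha3)
    · exact Or.inr (Or.inr hb3)
  exact hN f₀ u hu

/-- every point of `A` has a box partner (for any two coordinates and pairs through it). -/
theorem exists_partner {g₁ g₂ : Fin 4} (hg : g₁ ≠ g₂) (t₁ t₂ : ZMod 4) (a : PT) :
    ∃ b ∈ box A g₁ t₁ g₂ t₂, b ≠ a := by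
  by_contra hne
  push Not at hne
  have h1 : (box A g₁ t₁ g₂ t₂).card ≤ 1 := by
    rw [Finset.card_le_one]
    intro x hx y hy
    rw [hne x hx, hne y hy]
  have := card_box hA8 hN hg t₁ t₂
  omega

/-! ### §7.3 All pairwise differences lie in `E8` -/

/-- **no odd difference** `b g = a g + 1`. -/
theorem diff_ne_one {a b : PT} (ha : a ∈ A) (hb : b ∈ A) (g : Fin 4) : b g ≠ a g + 1 := by
  intro hbg
  have hab : a ≠ b := by
    rintro rfl
    have : ∀ x : ZMod 4, x ≠ x + 1 := by decide
    exact this _ hbg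
  obtain ⟨h₁, h1g, -⟩ := exists_other g g
  by_cases hclose : ∃ h, h ≠ g ∧ (b h = a h ∨ b h = a h + 1 ∨ b h = a h + 3)
  · -- Case A: a second close coordinate h
    obtain ⟨h, hhg, hbh⟩ := hclose
    -- the pair at h through a h and b h
    obtain ⟨t₂, hat, hbt⟩ : ∃ t₂ : ZMod 4, (a h = t₂ ∨ a h = t₂ + 1) ∧ (b h = t₂ ∨ b h = t₂ + 1) := by
      have key : ∀ x y : ZMod 4, (y = x ∨ y = x + 1 ∨ y = x + 3) →
          ∃ t : ZMod 4, (x = t ∨ x = t + 1) ∧ (y = t ∨ y = t + 1) := by decide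
      exact key _ _ hbh
    -- Box₁ = (g : {a g, a g+1}) × (h : t₂) ∋ a, b ;  Box₂ = (g : {a g − 1, a g}) × (h : t₂) ∋ a, p
    have haB1 : a ∈ box A g (a g) h t₂ := mem_box.2 ⟨ha, Or.inl rfl, hat⟩
    have hbB1 : b ∈ box A g (a g) h t₂ := mem_box.2 ⟨hb, Or.inr hbg, hbt⟩
    have haB2 : a ∈ box A g (a g + 3) h t₂ := mem_box.2 ⟨ha, mem_pair_pred _, hat⟩
    obtain ⟨p, hpB2, hpa⟩ := exists_partner hA8 hN (Ne.symm hhg) (a g + 3) t₂ a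
    obtain ⟨hp, hpg, hpt⟩ := mem_box.1 hpB2
    -- the two remaining coordinates
    obtain ⟨h₂, h₃, h2g, h3g, h23⟩ := exists_two_others g
    -- hmm: we need h₂, h₃ ≠ g AND ≠ h; choose them as the two coordinates off {g, h}
    obtain ⟨k₂, k2g, k2h⟩ := exists_other g h
    obtain ⟨k₃, hk₃⟩ : ∃ k₃ : Fin 4, k₃ ≠ g ∧ k₃ ≠ h ∧ k₃ ≠ k₂ := by
      have key : ∀ g h k₂ : Fin 4, h ≠ g → k₂ ≠ g → k₂ ≠ h → ∃ k₃ : Fin 4, k₃ ≠ g ∧ k₃ ≠ h ∧ k₃ ≠ k₂ := by decide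
      exact key g h k₂ hhg k2g k2h
    obtain ⟨k3g, k3h, k32⟩ := hk₃
    -- b and p both sit at a + 2 on k₂, k₃
    have hb2 := opp_of_box hA8 hN (Ne.symm hhg) (a g) t₂ haB1 hbB1 hab k₂ k2g k2h
    have hb3 := opp_of_box hA8 hN (Ne.symm hhg) (a g) t₂ haB1 hbB1 hab k₃ k3g k3h
    have hp2 := opp_of_box hA8 hN (Ne.symm hhg) (a g + 3) t₂ haB2 hpB2 (Ne.symm hpa) k₂ k2g k2h
    have hp3 := opp_of_box hA8 hN (Ne.symm hhg) (a g + 3) t₂ haB2 hpB2 (Ne.symm hpa) k₃ k3g k3h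
    -- so p, b share the box (k₂ : {b k₂}) × (k₃ : {b k₃}); they differ (at g)
    have hpb : p ≠ b := by
      rintro rfl
      have key : ∀ x : ZMod 4, ¬((x + 1 = x + 3) ∨ (x + 1 = x + 3 + 1)) := by decide
      exact key _ (hbg ▸ hpg)
    have hpB3 : p ∈ box A k₂ (b k₂) k₃ (b k₃) := mem_box.2 ⟨hp, Or.inl (hp2.trans hb2.symm), Or.inl (hp3.trans hb3.symm)⟩
    have hbB3 : b ∈ box A k₂ (b k₂) k₃ (b k₃) := mem_box.2 ⟨hb, Or.inl rfl, Or.inl rfl⟩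
    have hh2 := opp_of_box hA8 hN k32.symm (b k₂) (b k₃) hpB3 hbB3 hpb h (Ne.symm k2h) (Ne.symm k3h)
    -- but b h, p h ∈ {t₂, t₂+1}: not opposite
    have key : ∀ x y t : ZMod 4, (x = t ∨ x = t + 1) → (y = t ∨ y = t + 1) → y ≠ x + 2 := by decide
    exact key _ _ _ hpt hbt hh2
  · -- Case B: every other coordinate is opposite
    push Not at hclose
    have hfar : ∀ h, h ≠ g → b h = a h + 2 := by
      intro h hh
      obtain ⟨h1, h2, h3⟩ := hclose h hh
      have key : ∀ x y : ZMod 4, y ≠ x → y ≠ x + 1 → y ≠ x + 3 → y = x + 2 := by decide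
      exact key _ _ h1 h2 h3
    obtain ⟨k₂, k₃, k2g, k3g, k23⟩ := exists_two_others g
    obtain ⟨k₁, hk1g, hk12, hk13⟩ : ∃ k₁ : Fin 4, k₁ ≠ g ∧ k₁ ≠ k₂ ∧ k₁ ≠ k₃ := by
      have key : ∀ g k₂ k₃ : Fin 4, ∃ k₁ : Fin 4, k₁ ≠ g ∧ k₁ ≠ k₂ ∧ k₁ ≠ k₃ := by decide
      exact key g k₂ k₃
    -- Box₁ = (g : {a g, a g+1}) × (k₁ : {a k₁, a k₁+1}) ∋ a; partner p
    have haB1 : a ∈ box A g (a g) k₁ (a k₁) := mem_box.2 ⟨ha, Or.inl rfl, Or.inl rfl⟩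
    obtain ⟨p, hpB1, hpa⟩ := exists_partner hA8 hN (Ne.symm hk1g) (a g) (a k₁) a
    obtain ⟨hp, hpg, hpk⟩ := mem_box.1 hpB1
    have hp2 := opp_of_box hA8 hN (Ne.symm hk1g) (a g) (a k₁) haB1 hpB1 (Ne.symm hpa) k₂ k2g (Ne.symm hk12)
    have hp3 := opp_of_box hA8 hN (Ne.symm hk1g) (a g) (a k₁) haB1 hpB1 (Ne.symm hpa) k₃ k3g (Ne.symm hk13)
    have hb2 := hfar k₂ k2g
    have hb3 := hfar k₃ k3g
    have hpb : p ≠ b := by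
      rintro rfl
      have key : ∀ x : ZMod 4, ¬(x + 2 = x ∨ x + 2 = x + 1) := by decide
      exact key _ ((hfar k₁ hk1g) ▸ hpk)
    have hpB3 : p ∈ box A k₂ (b k₂) k₃ (b k₃) := mem_box.2 ⟨hp, Or.inl (hp2.trans hb2.symm), Or.inl (hp3.trans hb3.symm)⟩
    have hbB3 : b ∈ box A k₂ (b k₂) k₃ (b k₃) := mem_box.2 ⟨hb, Or.inl rfl, Or.inl rfl⟩
    have hhg := opp_of_box hA8 hN k23 (b k₂) (b k₃) hpB3 hbB3 hpb g (Ne.symm k2g) (Ne.symm k3g)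
    -- b g = a g + 1 and p g ∈ {a g, a g+1}: not opposite
    have key : ∀ x y : ZMod 4, (y = x ∨ y = x + 1) → x + 1 ≠ y + 2 := by decide
    exact key _ _ hpg (hbg ▸ hhg)

/-- all differences are even: `b g ∈ {a g, a g + 2}`. -/
theorem diff_even {a b : PT} (ha : a ∈ A) (hb : b ∈ A) (g : Fin 4) : b g = a g ∨ b g = a g + 2 := by
  have h1 := diff_ne_one hA8 hN ha hb g
  have h3 : b g ≠ a g + 3 := fun e => diff_ne_one hA8 hN hb ha g (by rw [e, add_three_add_one])
  have key : ∀ x y : ZMod 4, y ≠ x + 1 → y ≠ x + 3 → y = x ∨ y = x + 2 := by decide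
  exact key _ _ h1 h3

/-- **all differences lie in `E8`** (even entries, even weight). -/
theorem sub_mem_e8Set {a b : PT} (ha : a ∈ A) (hb : b ∈ A) : b - a ∈ e8Set := by
  have hev : ∀ f, (b - a) f = 0 ∨ (b - a) f = 2 := fun f => by
    rcases diff_even hA8 hN ha hb f with e | e <;> simp [e]
  refine mem_e8Set.2 ⟨mem_evenSet.2 hev, ?_⟩
  by_contra hsum
  -- odd weight: one coordinate k differs from the three others
  obtain ⟨k, hk⟩ : ∃ k : Fin 4, ∀ f, f ≠ k → (b - a) f = (b - a) k + 2 := by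
    have key : ∀ x₀ x₁ x₂ x₃ : ZMod 4, (x₀ = 0 ∨ x₀ = 2) → (x₁ = 0 ∨ x₁ = 2) → (x₂ = 0 ∨ x₂ = 2) → (x₃ = 0 ∨ x₃ = 2) →
        x₀ + x₁ + x₂ + x₃ ≠ 0 → ∃ k : Fin 4, ∀ f : Fin 4, f ≠ k → ![x₀, x₁, x₂, x₃] f = ![x₀, x₁, x₂, x₃] k + 2 := by
      decide
    have hd : (b - a) = ![(b - a) 0, (b - a) 1, (b - a) 2, (b - a) 3] := by
      funext f; fin_cases f <;> rfl
    have hs : (b - a) 0 + (b - a) 1 + (b - a) 2 + (b - a) 3 ≠ 0 := by rwa [Fin.sum_univ_four] at hsum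
    obtain ⟨k, hk⟩ := key _ _ _ _ (hev 0) (hev 1) (hev 2) (hev 3) hs
    exact ⟨k, fun f hf => by have := hk f hf; rwa [← hd] at this⟩
  have hab : a ≠ b := by
    rintro rfl; apply hsum; simp
  rcases hev k with hk0 | hk2
  · -- weight 3: (b - a) k = 0, others 2.  Partner p of a in the box (k : a k) × (g : a g), g ≠ k.
    obtain ⟨g, k₂, hgk, hk2k, hgk2⟩ := exists_two_others k
    obtain ⟨k₃, hk3k, hk3g, hk32⟩ : ∃ k₃ : Fin 4, k₃ ≠ k ∧ k₃ ≠ g ∧ k₃ ≠ k₂ := by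
      have key : ∀ k g k₂ : Fin 4, g ≠ k → k₂ ≠ k → g ≠ k₂ → ∃ k₃ : Fin 4, k₃ ≠ k ∧ k₃ ≠ g ∧ k₃ ≠ k₂ := by decide
      exact key k g k₂ hgk hk2k hgk2
    have haB : a ∈ box A k (a k) g (a g) := mem_box.2 ⟨ha, Or.inl rfl, Or.inl rfl⟩
    obtain ⟨p, hpB, hpa⟩ := exists_partner hA8 hN (Ne.symm hgk) (a k) (a g) a
    obtain ⟨hp, hpk, hpg⟩ := mem_box.1 hpB
    have hp2 := opp_of_box hA8 hN (Ne.symm hgk) (a k) (a g) haB hpB (Ne.symm hpa) k₂ hk2k (Ne.symm hgk2)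
    have hp3 := opp_of_box hA8 hN (Ne.symm hgk) (a k) (a g) haB hpB (Ne.symm hpa) k₃ hk3k hk3g
    have hx : ∀ f, f ≠ k → b f = a f + 2 := fun f hf => by
      have := hk f hf
      rw [hk0, zero_add, Pi.sub_apply, sub_eq_iff_eq_add, add_comm] at this
      exact this
    have hb2 := hx k₂ hk2k
    have hb3 := hx k₃ hk3k
    have hbg := hx g hgk
    have hbk : b k = a k := by rw [Pi.sub_apply, sub_eq_zero] at hk0; exact hk0
    have hpb : p ≠ b := by
      rintro rfl
      have key : ∀ x : ZMod 4, ¬(x + 2 = x ∨ x + 2 = x + 1) := by decide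
      exact key _ (hbg ▸ hpg)
    have hpB3 : p ∈ box A k₂ (b k₂) k₃ (b k₃) := mem_box.2 ⟨hp, Or.inl (hp2.trans hb2.symm), Or.inl (hp3.trans hb3.symm)⟩
    have hbB3 : b ∈ box A k₂ (b k₂) k₃ (b k₃) := mem_box.2 ⟨hb, Or.inl rfl, Or.inl rfl⟩
    have hk' := opp_of_box hA8 hN hk32.symm (b k₂) (b k₃) hpB3 hbB3 hpb k (Ne.symm hk2k) (Ne.symm hk3k)
    -- b k = a k, p k ∈ {a k, a k + 1}: not opposite
    have key : ∀ x y : ZMod 4, (y = x ∨ y = x + 1) → x ≠ y + 2 := by decide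
    exact key _ _ hpk (hbk ▸ hk')
  · -- weight 1: (b - a) k = 2, others 0: a, b agree on two coordinates but are not opposite on the third
    obtain ⟨g, k₂, hgk, hk2k, hgk2⟩ := exists_two_others k
    obtain ⟨k₃, hk3k, hk3g, hk32⟩ : ∃ k₃ : Fin 4, k₃ ≠ k ∧ k₃ ≠ g ∧ k₃ ≠ k₂ := by
      have key : ∀ k g k₂ : Fin 4, g ≠ k → k₂ ≠ k → g ≠ k₂ → ∃ k₃ : Fin 4, k₃ ≠ k ∧ k₃ ≠ g ∧ k₃ ≠ k₂ := by decide
      exact key k g k₂ hgk hk2k hgk2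
    have e0 : ∀ f, f ≠ k → b f = a f := fun f hf => by
      have := hk f hf; rw [hk2] at this
      have h4 : (2 : ZMod 4) + 2 = 0 := by decide
      rw [h4, Pi.sub_apply, sub_eq_zero] at this; exact this
    have haB : a ∈ box A k₂ (a k₂) k₃ (a k₃) := mem_box.2 ⟨ha, Or.inl rfl, Or.inl rfl⟩
    have hbB : b ∈ box A k₂ (a k₂) k₃ (a k₃) := mem_box.2 ⟨hb, Or.inl (e0 k₂ hk2k), Or.inl (e0 k₃ hk3k)⟩
    have hg' := opp_of_box hA8 hN hk32.symm (a k₂) (a k₃) haB hbB hab g hgk2 (Ne.symm hk3g)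
    rw [e0 g hgk] at hg'
    have key : ∀ x : ZMod 4, x ≠ x + 2 := by decide
    exact key _ hg'

/-- **the non-hosted case of the dichotomy**: `A` lies in the E8-coset of any of its points. -/
theorem subset_e8_coset {a : PT} (ha : a ∈ A) : A ⊆ e8Set.image (· + a) := by
  intro b hb
  exact Finset.mem_image.2 ⟨b - a, sub_mem_e8Set hA8 hN ha hb, sub_add_cancel b a⟩

end structure_

/-! ### §7.4 The dichotomy, and `phaseTorusLaw8_holds` -/

/-- **THE 8-SET DICHOTOMY** (kernel): a set of at most 8 phases is box-hosted or lies in an E8-coset. -/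
theorem eightDichotomy_holds : EightDichotomy := by
  intro A hA8
  by_cases hh : ∃ f₀ s, BoxHosted A f₀ s
  · exact Or.inl hh
  · push Not at hh
    right
    by_cases hne : A = ∅
    · exact ⟨0, by rw [hne]; exact Finset.empty_subset _⟩
    · obtain ⟨a, ha⟩ := Finset.nonempty_iff_ne_empty.2 hne
      exact ⟨a, subset_e8_coset hA8 hh ha⟩


/-- **THE PHASE-TORUS LAW HOLDS AT CORANK 8** (kernel, unconditional; F1 target (a) `phaseTorusLaw8_holds`):
box law (v4 `rot_step`) on hosted 8-sets, E8 law (§5) on the others (§7). -/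
theorem phaseTorusLaw8_holds : PhaseTorusLawN 8 := phaseTorusLawN_eight_of_dichotomy eightDichotomy_holds

/-- alias in the director's vocabulary (F1 target (b)). -/
theorem not_phaseTorusLaw16 : ¬ PhaseTorusLawN 16 := not_phaseTorusLawN_sixteen

/-- **THRESHOLD (kernel part)**: true at every corank `≤ 8`, false at every corank `≥ 16`; `9…15` open. -/
theorem threshold_kernel : (∀ γ, γ ≤ 8 → PhaseTorusLawN γ) ∧ (∀ γ, 16 ≤ γ → ¬ PhaseTorusLawN γ) :=
  ⟨fun _ h => phaseTorusLawN_mono h phaseTorusLaw8_holds, fun _ h => not_phaseTorusLawN_of_le h⟩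

end Summit.HodgeConjecture.HodgeConjecture.Cruxes.BlochSeedDiscOne.PhaseTorus
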